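/-
Copyright (c) 2026 the pub-hodgecm-mathlib formalisation cell (harness21).  Prover seat hodgecm-mathlib-LH4-p10 (g2), req620 Track A «(D-RAM) FOUR-FRAME» squad
(MS ROAD A, Stage B brick B5 (ii) of SPEC `F0/P3c/LH4/LH4-p10/g2/SPEC-StageB.v2-B5split.LH4p10g2.md`).  2026-09-04.
-/
import Summits.HodgeConjecture.HodgeConjecture.Theorems.F0P3cDyRamDiagonalHNFStability   -- ★ p855216 `mapGL_latt_hnf_eq_iff` (the three T-stability congruences of an HNF lattice)
import HarnessLib

/-!
# Crux `H413`, MS ROAD A, STAGE B brick B5 (ii): «STABILITY READING ON THE GLUED STRATUM»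

Cell `hodgecm-mathlib` (D-0151), FLOOR 0, crux item H413 = `stmt-HodgeConjecture-24833`; lane `--supports stmt-HodgeConjecture-24833 --as helper` (count-neutral).  THEOREMS ONLY.
LH4-p10 (g2) MEMO v2 §4: on the glued stratum `V = (1 0 0; x ϖ^ρ 0; xζ + y″ ϖ^ρζ ϖ^{2ρ+s})` (`x, ζ` units) the three `T`-stability congruences of ★ p855216 for `T = diag(α, β, 1)`
read (S2) `|(β−α)x| ≤ |ϖ|^ρ`, (S1) `|(β−1)ζ| ≤ |ϖ|^{ρ+s}`, (S3) `|(β−1)xζ + (α−1)y″| ≤ |ϖ|^{2ρ+s}` — the substitution `A + C = B` (`A = α−1`, `B = β−1`, `C = β−α`) that produces the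
TUBE condition `r + s ≤ n₁ ∧ r ≤ n₂` (no cancellation) and the GLUE congruence `y″ ≡ −(B∕A)xζ` (cancellation, `n₁ = n₂ + s`).
* `mapGL_latt_hnf_glued_eq_iff` — the three congruences in `(x, ζ, y″)` coordinates.
* `mapGL_latt_hnf_glued_eq_of_depths` — TUBE: `2ρ + s ≤ n₁`, `2ρ ≤ n₂`, `ρ ≤ n₃` ⟹ stable, for EVERY point of the stratum.
* `mapGL_latt_hnf_glued_eq_iff_of_ne` — conversely, off the glue foot (`n₁ ≠ n₂ + s`) stability forces `2ρ + s ≤ n₁ ∧ 2ρ ≤ n₂`.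
HONEST LABEL.  Count-neutral; `HC_CM` is proved only modulo the 7 printed citations (2 remaining named inputs: hLiu418 = `stmt-HodgeConjecture-24832`, h413 = `stmt-HodgeConjecture-24833`) until rung 0 closes.

## References
* [Kottwitz1986BaseChangeUnits] R. Kottwitz, *Base change for unit elements of Hecke algebras*, Compositio Math. 60 (1986), §1 pp. 240–241 (fixed-lattice counting).
* [Serre1980Trees] J.-P. Serre, *Trees*, Springer (1980), Ch. II §1.1 (lattices `g·𝒪^N`, Hermite normal form).
* [BruhatTits1972] F. Bruhat, J. Tits, *Groupes réductifs sur un corps local I*, Publ. Math. IHÉS 41 (1972), §10.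
-/

set_option autoImplicit false

noncomputable section

namespace Summit.HodgeConjecture.HodgeConjecture.Cruxes.H413.F0P3cDyRamDiagonalGluedStability

open Matrix
open Literature.NumberTheory.Automorphic Literature.NumberTheory.Automorphic.HermitianLattice Literature.NumberTheory.Automorphic.UnitaryGroup
open Literature.NumberTheory.Automorphic.UnitaryLatticeTree
open Summit.HodgeConjecture.HodgeConjecture.Cruxes.H413.F0P3cDyRamDiagonalHNFStability
open scoped Valued WithZero Matrix MatrixGroups

variable {K : Type*} [Field K] [Valued K ℤᵐ⁰]

/-- In `ℤᵐ⁰`: `|a · (ϖ^n)⁻¹| ≤ 1 ↔ |a| ≤ |ϖ|^n` (`ϖ ≠ 0`). [cite: Serre1980Trees, Ch. II §1.1] -/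
theorem v_mul_inv_pow_le_one_iff {ϖ : K} (hϖ : ϖ ≠ 0) (a : K) (n : ℕ) :
    Valued.v (a * (ϖ ^ n)⁻¹) ≤ 1 ↔ Valued.v a ≤ Valued.v ϖ ^ n := by
  have hpos : 0 < Valued.v (ϖ ^ n) := (Valuation.pos_iff _).2 (pow_ne_zero _ hϖ)
  rw [map_mul, map_inv₀, mul_inv_le_iff₀ hpos, one_mul, map_pow]

/-- **THE THREE STABILITY CONGRUENCES ON THE GLUED STRATUM** (`T = diag(α, β, 1)` with unit `α, β`; `V = (1 0 0; x ϖ^ρ 0; xζ+y″ ϖ^ρζ ϖ^{2ρ+s})`):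
`T·latt V = latt V ↔ |(β−α)x| ≤ |ϖ|^ρ ∧ |(β−1)ζ| ≤ |ϖ|^{ρ+s} ∧ |(β−1)xζ + (α−1)y″| ≤ |ϖ|^{2ρ+s}` — ★ p855216 with `(α−1) + (β−α) = β−1`. [cite: Kottwitz1986BaseChangeUnits, §1 pp. 240–241] [cite: Serre1980Trees, Ch. II §1.1] -/
theorem mapGL_latt_hnf_glued_eq_iff {ϖ : K} (hϖ : ϖ ≠ 0) {α β : K} (hα : Valued.v α = 1) (hβ : Valued.v β = 1) (T : GL (Fin 3) K)
    (hT : (T : Matrix (Fin 3) (Fin 3) K) = Matrix.diagonal ![α, β, 1]) (ρ s : ℕ) (x ζ y'' : K) (V : GL (Fin 3) K)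
    (hV : (V : Matrix (Fin 3) (Fin 3) K) = !![1, 0, 0; x, ϖ ^ ρ, 0; x * ζ + y'', ϖ ^ ρ * ζ, ϖ ^ (2 * ρ + s)]) :
    mapGL T (latt (V : Matrix (Fin 3) (Fin 3) K)) = latt (V : Matrix (Fin 3) (Fin 3) K) ↔
      Valued.v ((β - α) * x) ≤ Valued.v ϖ ^ ρ ∧ Valued.v ((β - 1) * ζ) ≤ Valued.v ϖ ^ (ρ + s) ∧
        Valued.v ((β - 1) * x * ζ + (α - 1) * y'') ≤ Valued.v ϖ ^ (2 * ρ + s) := by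
  have hs : ∀ i, Valued.v ((![α, β, 1] : Fin 3 → K) i) = 1 := by
    intro i; fin_cases i
    · exact hα
    · exact hβ
    · exact map_one _
  rw [mapGL_latt_hnf_eq_iff hϖ ![α, β, 1] hs T hT V hV]
  simp only [Matrix.cons_val_zero, Matrix.cons_val_one, Matrix.cons_val_two, Matrix.head_cons, Matrix.tail_cons]
  have hρ0 : (ϖ ^ ρ : K) ≠ 0 := pow_ne_zero _ hϖ
  -- (S2)
  rw [v_mul_inv_pow_le_one_iff hϖ]
  -- (S1): `(1 − β)·(ϖ^ρ ζ)·(ϖ^{2ρ+s})⁻¹ = −((β−1)ζ)·(ϖ^{ρ+s})⁻¹`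
  have e1 : (1 - β) * (ϖ ^ ρ * ζ) * (ϖ ^ (2 * ρ + s))⁻¹ = -((β - 1) * ζ) * (ϖ ^ (ρ + s))⁻¹ := by
    rw [show 2 * ρ + s = ρ + (ρ + s) by ring, pow_add]; field_simp; ring
  -- (S3): `((1−α)(xζ+y″) + (α−β)x(ϖ^ρζ)(ϖ^ρ)⁻¹)·(ϖ^{2ρ+s})⁻¹ = −((β−1)xζ + (α−1)y″)·(ϖ^{2ρ+s})⁻¹`
  have e3 : ((1 - α) * (x * ζ + y'') + (α - β) * x * (ϖ ^ ρ * ζ) * (ϖ ^ ρ)⁻¹) * (ϖ ^ (2 * ρ + s))⁻¹ =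
      -((β - 1) * x * ζ + (α - 1) * y'') * (ϖ ^ (2 * ρ + s))⁻¹ := by
    field_simp; ring
  rw [e1, e3, neg_mul, neg_mul, Valuation.map_neg, Valuation.map_neg, v_mul_inv_pow_le_one_iff hϖ, v_mul_inv_pow_le_one_iff hϖ]

/-- **TUBE ⟹ STABLE, point-free**: if `|β−1| = |ϖ|^{n₁}`, `|α−1| = |ϖ|^{n₂}`, `|β−α| = |ϖ|^{n₃}` with `2ρ + s ≤ n₁`, `2ρ ≤ n₂`, `ρ ≤ n₃`, then EVERY point of the glued stratum
(`|x| = |ζ| = 1`, `|y″| = |ϖ|^s`) is `T`-stable. [cite: Kottwitz1986BaseChangeUnits, §1 pp. 240–241] -/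
theorem mapGL_latt_hnf_glued_eq_of_depths {ϖ : K} (hϖ : ϖ ≠ 0) (hϖ1 : Valued.v ϖ ≤ 1) {α β : K} (hα : Valued.v α = 1) (hβ : Valued.v β = 1)
    (T : GL (Fin 3) K) (hT : (T : Matrix (Fin 3) (Fin 3) K) = Matrix.diagonal ![α, β, 1]) {n₁ n₂ n₃ : ℕ}
    (h₁ : Valued.v (β - 1) = Valued.v ϖ ^ n₁) (h₂ : Valued.v (α - 1) = Valued.v ϖ ^ n₂) (h₃ : Valued.v (β - α) = Valued.v ϖ ^ n₃)
    (ρ s : ℕ) (hρ₁ : 2 * ρ + s ≤ n₁) (hρ₂ : 2 * ρ ≤ n₂) (hρ₃ : ρ ≤ n₃) {x ζ y'' : K} (hx : Valued.v x = 1) (hζ : Valued.v ζ = 1)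
    (hy'' : Valued.v y'' = Valued.v ϖ ^ s) (V : GL (Fin 3) K)
    (hV : (V : Matrix (Fin 3) (Fin 3) K) = !![1, 0, 0; x, ϖ ^ ρ, 0; x * ζ + y'', ϖ ^ ρ * ζ, ϖ ^ (2 * ρ + s)]) :
    mapGL T (latt (V : Matrix (Fin 3) (Fin 3) K)) = latt (V : Matrix (Fin 3) (Fin 3) K) := by
  have hle : ∀ {m n : ℕ}, m ≤ n → Valued.v ϖ ^ n ≤ Valued.v ϖ ^ m := fun h => pow_le_pow_right_of_le_one' hϖ1 h
  rw [mapGL_latt_hnf_glued_eq_iff hϖ hα hβ T hT ρ s x ζ y'' V hV]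
  refine ⟨?_, ?_, ?_⟩
  · rw [map_mul, hx, mul_one, h₃]; exact hle hρ₃
  · rw [map_mul, hζ, mul_one, h₁]; exact hle (by omega)
  · refine (Valuation.map_add _ _ _).trans (max_le ?_ ?_)
    · rw [map_mul, map_mul, hx, hζ, mul_one, mul_one, h₁]; exact hle hρ₁
    · rw [map_mul, h₂, hy'', ← pow_add]; exact hle (by omega)

/-- Ultrametric: if `|a| ≠ |b|` then `|a + b| = max |a| |b|`; in particular `|a + b| ≤ c` forces `|a| ≤ c` and `|b| ≤ c`. [cite: Serre1980Trees, Ch. II §1.1] -/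
theorem v_le_and_v_le_of_v_add_le_of_ne {a b : K} (hne : Valued.v a ≠ Valued.v b) {c : ℤᵐ⁰} (h : Valued.v (a + b) ≤ c) :
    Valued.v a ≤ c ∧ Valued.v b ≤ c := by
  rw [Valuation.map_add_of_distinct_val _ hne] at h
  exact ⟨(le_max_left _ _).trans h, (le_max_right _ _).trans h⟩

/-- **OFF THE GLUE FOOT, STABLE ⟹ TUBE**: if `n₁ ≠ n₂ + s` (no cancellation is possible in (S3)) then stability of a point of the glued stratum forces `2ρ + s ≤ n₁` and `2ρ ≤ n₂`
(`|ϖ| < 1` makes `n ↦ |ϖ|^n` strictly decreasing). [cite: Kottwitz1986BaseChangeUnits, §1 pp. 240–241] -/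
theorem depths_of_mapGL_latt_hnf_glued_eq {ϖ : K} (hϖ : ϖ ≠ 0) (hϖ1 : Valued.v ϖ < 1) {α β : K} (hα : Valued.v α = 1) (hβ : Valued.v β = 1)
    (T : GL (Fin 3) K) (hT : (T : Matrix (Fin 3) (Fin 3) K) = Matrix.diagonal ![α, β, 1]) {n₁ n₂ : ℕ}
    (h₁ : Valued.v (β - 1) = Valued.v ϖ ^ n₁) (h₂ : Valued.v (α - 1) = Valued.v ϖ ^ n₂)
    (ρ s : ℕ) (hne : n₁ ≠ n₂ + s) {x ζ y'' : K} (hx : Valued.v x = 1) (hζ : Valued.v ζ = 1)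
    (hy'' : Valued.v y'' = Valued.v ϖ ^ s) (V : GL (Fin 3) K)
    (hV : (V : Matrix (Fin 3) (Fin 3) K) = !![1, 0, 0; x, ϖ ^ ρ, 0; x * ζ + y'', ϖ ^ ρ * ζ, ϖ ^ (2 * ρ + s)])
    (hstab : mapGL T (latt (V : Matrix (Fin 3) (Fin 3) K)) = latt (V : Matrix (Fin 3) (Fin 3) K)) :
    2 * ρ + s ≤ n₁ ∧ 2 * ρ ≤ n₂ := by
  have hvϖ : 0 < Valued.v ϖ := (Valuation.pos_iff _).2 hϖ
  have hinj : ∀ {m n : ℕ}, Valued.v ϖ ^ m ≤ Valued.v ϖ ^ n → n ≤ m := fun {m n} h => by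
    by_contra hlt; rw [not_le] at hlt
    exact absurd h (not_le.2 (pow_lt_pow_right_of_lt_one₀ hvϖ hϖ1 hlt))
  obtain ⟨-, -, h3⟩ := (mapGL_latt_hnf_glued_eq_iff hϖ hα hβ T hT ρ s x ζ y'' V hV).1 hstab
  have hva : Valued.v ((β - 1) * x * ζ) = Valued.v ϖ ^ n₁ := by rw [map_mul, map_mul, h₁, hx, hζ, mul_one, mul_one]
  have hvb : Valued.v ((α - 1) * y'') = Valued.v ϖ ^ (n₂ + s) := by rw [map_mul, h₂, hy'', pow_add]
  have hne' : Valued.v ((β - 1) * x * ζ) ≠ Valued.v ((α - 1) * y'') := by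
    rw [hva, hvb]
    exact fun h => hne (pow_right_injective₀ hvϖ hϖ1.ne h)
  obtain ⟨ha, hb⟩ := v_le_and_v_le_of_v_add_le_of_ne hne' h3
  rw [hva] at ha
  rw [hvb] at hb
  exact ⟨hinj ha, by have := hinj hb; omega⟩

end Summit.HodgeConjecture.HodgeConjecture.Cruxes.H413.F0P3cDyRamDiagonalGluedStability

end
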